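import Summits.CriticalPhenomena.PercolationContinuityZ3.Theses.PercNecklaceBackbone
import Summits.CriticalPhenomena.PercolationContinuityZ3.Theses.PercTruncatedSusceptibility
import Literature.Probability.Percolation.BernoulliPercolationProofs
import Summits.CriticalPhenomena.PercolationContinuityZ3.Theorems.PercNecklaceBackboneTruncatedSusceptibilityFiniteOfThetaStubSupercriticalRadiusMoment
import Summits.CriticalPhenomena.PercolationContinuityZ3.Theorems.PercNecklaceBackboneTruncatedSusceptibilityFiniteOfThetaStubChiFiniteOfRadiusMoment
import Summits.CriticalPhenomena.PercolationContinuityZ3.Theorems.PercNecklaceBackboneTruncatedSusceptibilityFiniteOfThetaOfRayRenewal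

/-!
# Birth skeleton (BC3) for the crux `TruncatedSusceptibilityFiniteOfTheta` (stmt-CriticalPhenomena-0852)

Route `route-CriticalPhenomena-PercNecklaceBackbone` (sub-problem `PercolationContinuityZ3`), crux decl
`Summit.CriticalPhenomena.PercolationContinuityZ3.Theses.PercNecklaceBackbone.TruncatedSusceptibilityFiniteOfTheta`
(rank 4 there; the item is SHARED by signature with `PercTruncatedSusceptibility` (rank 3, the crux's home
route, whose `closes` consumes it directly) and `PercAntiMeanFieldOnset` (rank 3)) — "L":
for every `p` with `θ(p) > 0`, the truncated connectivity of bond percolation on `ℤ³` is summable,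
`Σ_x P_p(0 ↔ x, |C(0)| < ∞) < ∞` (`χᶠ(p) < ∞`).

THE LINE (Grimmett's own order (8.21) ⇒ (8.51) ⇒ summation, cut by regime). `θ(p) > 0` forces
`p_c ≤ p` (definition of `p_c` as an infimum, proved here: `criticalProb_le_of_theta_pos'`), so the crux
splits EXACTLY into the supercritical regime `p > p_c` (a theorem in print) and the single point
`p = p_c` under the hypothesis `θ(p_c) > 0` (the live, hypothetical case: "no sprinkling"); and at any
`p` the volume statement `χᶠ(p) < ∞` is fed by the RADIUS law of finite clusters through first-exit +
shell counting. Three registered stubs: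

* STUB 1 `stub_supercriticalRadiusMoment` (KNOWN THEOREM, PROVABLE NOW — lead's reshape 2026-08-17 of the
  birth stub `stub_supercriticalChiFinite`): `p_c < p ⇒ Σ_n (n+1)² P_p(0 ↔ ∂B(n), |C| < ∞) < ∞` — the
  supercritical regime stated on the RADIUS law, so that STUB 3 serves both regimes. In print this is
  Grimmett 1999 Thm (8.21) (`σ(p) > 0` for `p > p_c`, `d ≥ 3`, via a slab percolating at `p`); IN TREE it
  follows from the DISCHARGED fact `DuminilcopinKozmaTassion2020_thm2_supercritical_holds`
  (`CorrelationLengthDKTSupercritical.lean`: for `p ∈ (p_c,1)`, `0 < exp(−C/(p−p_c)²) ≤ liminf_n −(1/n)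
  log P_p[siteToBoundary 3 n ∩ (percolatesAt 0)ᶜ]`, hence eventual exponential decay of `radF p n`) and
  `DCT16.theta_one` (`θ(1) = 1`, so `radF 1 ≡ 0`). The birth stub `SupercriticalChiFinite` (= item
  stmt-CriticalPhenomena-0854 verbatim) is recovered as `supercriticalChiFinite_of_stubs` (STUB 1 + STUB 3).
* STUB 2 `stub_criticalRadiusMoment` (OPEN — LOAD-BEARING): **at a percolating `p_c`, the finite-cluster
  radius has a finite second moment in shell form** — `θ(p_c) > 0 ⇒ Σ_n (n+1)² · P_{p_c}(0 ↔ ∂B(n), |C(0)| < ∞) < ∞`.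
  This is the `p = p_c` instance of the line, stated one level BELOW the crux (radius, not volume): it is
  implied by the `p_c`-instance of the sibling crux `FiniteRadiusExpDecayOfTheta` (stmt-0853, exponential
  radius decay; `criticalRadiusMoment_of_expDecay` below, proved) and implies the `p_c`-instance of L
  through STUB 3, but is NOT implied by L (thin clusters: large radius, small volume). Vacuously true in
  the real world (`θ(p_c) = 0`); refutable only by first exhibiting `θ(p_c) > 0` (kill criterion (iv) of
  the route). Why it might fail: in a jump world nothing forces finite clusters at `p_c` to be small —
  every engine in print (Grimmett (8.21)) needs a slab percolating AT `p`, and none does at `p_c`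
  (DST 2016); `Literature.Barriers.CriticalPhenomena.SprinklingRenormalisation` is met head-on exactly here.
* STUB 3 `stub_chiFiniteOfRadiusMoment` (M, PROVABLE NOW): **volume from radius** — at every `p`,
  `Σ_n (n+1)² P_p(0 ↔ ∂B(n), |C| < ∞) < ∞ ⇒ Σ_x P_p(0 ↔ x, |C| < ∞) < ∞`. Proof sketch: for `x` with
  `‖x‖_∞ = m ≥ 1`, `x ∉ B(m−1)`, and `P_p`-a.s. (`ω ⊆ E(ℤ³)`, `DCT16.real_mono_of_forall_subset_edgeSet`)
  an open path `0 → x` exits `B(m−1)` through its inner boundary (first-exit argument of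
  `tau_le_real_siteToBoundary`, ContinuityCriterion.lean — intersect both sides with `{|C(0)| < ∞}`), so
  `τᶠ_p(0,x) ≤ P_p(0 ↔ ∂B(m−1), |C| < ∞)`; the shell `{‖x‖_∞ = m}` has `(2m+1)³ − (2m−1)³ = 24m² + 2 ≤ 26 m²`
  sites (`card_box`); sum over shells (nonnegative terms, `Summable.of_nonneg_of_le` after reindexing
  `Site 3` by shells).

Composition (kernel-checked, no `sorry`): `TruncatedSusceptibilityFiniteOfTheta_of : stub_criticalRadiusMoment →
TruncatedSusceptibilityFiniteOfTheta` (hypothesis typed by the name-keyed alias `__Registered.stub_criticalRadiusMoment`;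
after wave 1 the two LANDED stubs are discharged inside the proof): given `θ(p) > 0`, `p_c ≤ p`; if `p_c < p`
use STUB 3 ∘ STUB 1; else `p = p_c` as points of `[0,1]` (`Subtype.ext`, `coe_criticalProbI`) and STUB 3 ∘ STUB 2.
The same term concludes the sibling decl `PercTruncatedSusceptibility.TruncatedSusceptibilityFiniteOfTheta`
(`…_of'`, definitional).

DISPROOF USED: none exists for this crux (`ledger crux ls stmt-CriticalPhenomena-0852`: no workfiles,
no `Disproof.lean`, no landed Negative lemma, 2026-08-17). Negatives index of the summit (11 entries):
not touched (no truncated-connectivity / finite-cluster-radius statement). Honest-piece check: STUB 1 is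
a theorem IN TREE (DKT 2020 Thm 2, discharged) whose volume shadow `SupercriticalChiFinite` is a
CONSEQUENCE of the crux (`supercriticalChiFinite_of_crux`, via `θ(p) > 0` for `p > p_c`,
`theta_pos_of_criticalProb_lt_holds`); STUB 3 is a theorem; STUB 2 is the one strengthening (radius for
volume, at `p_c` only), sandwiched between filed items 0853 ⇒ STUB 2 ⇒ (with STUB 3) L(p_c).
-/

noncomputable section

namespace Summit.CriticalPhenomena.PercolationContinuityZ3.Cruxes.TruncatedSusceptibilityFiniteOfTheta.Birth

open MeasureTheory Literature.Probability.Percolation Literature.Probability.LatticeModels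
open Summit.CriticalPhenomena.PercolationContinuityZ3.Theses.PercNecklaceBackbone (TruncatedSusceptibilityFiniteOfTheta)

/-! ## Objects of the line -/

/-- Bond percolation on `ℤ³` at density `p`. -/
abbrev μ (p : unitInterval) : Measure (BondConfig (Site 3)) := bondPercolation (zdGraph 3) p

/-- The truncated connectivity `τᶠ_p(0,x) = P_p(0 ↔ x, |C(0)| < ∞)` (Grimmett 1999, (8.49)). -/
abbrev tauF (p : unitInterval) (x : Site 3) : ℝ :=
  (bondPercolation (zdGraph 3) p).real (openConn 0 x \ percolatesAt 0)

/-- The finite-cluster one-arm probability `P_p(0 ↔ ∂B(n), |C(0)| < ∞)` (the quantity of Grimmett 1999,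
Thm (8.21); event `siteToBoundary 3 n \ percolatesAt 0`, as in the sibling crux `FiniteRadiusExpDecayOfTheta`). -/
abbrev radF (p : unitInterval) (n : ℕ) : ℝ :=
  (bondPercolation (zdGraph 3) p).real (siteToBoundary 3 n \ percolatesAt 0)

/-- `χᶠ(p) < ∞`: the truncated connectivity is summable over `ℤ³` (spelled as in the crux). -/
def ChiFinite (p : unitInterval) : Prop :=
  Summable fun x : Site 3 => (bondPercolation (zdGraph 3) p).real (openConn 0 x \ percolatesAt 0)

/-- Finite second radius moment of finite clusters, in shell form: `Σ_n (n+1)² P_p(0 ↔ ∂B(n), |C| < ∞) < ∞`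
(spelled out in tree vocabulary, exactly as in the registered stub signatures). -/
def RadiusMomentFinite (p : unitInterval) : Prop :=
  Summable fun n : ℕ => ((n : ℝ) + 1) ^ 2 * (bondPercolation (zdGraph 3) p).real (siteToBoundary 3 n \ percolatesAt 0)

/-- The crux is literally `∀ p, θ(p) > 0 → χᶠ(p) < ∞`. -/
theorem crux_iff :
    TruncatedSusceptibilityFiniteOfTheta ↔ ∀ p : unitInterval, 0 < theta (zdGraph 3) 0 p → ChiFinite p :=
  Iff.rfl

/-! ## The three stub statements
Each is written out in tree vocabulary (no local definition inside), so that a stub's Theorems file can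
state the registered signature verbatim under the same `open`s. -/

/-- STUB 1 statement (the supercritical regime, on the radius law): `p_c < p ⇒ Σ_n (n+1)² radF p n < ∞`.
In tree via `DuminilcopinKozmaTassion2020_thm2_supercritical_holds` (`p < 1`) and `DCT16.theta_one` (`p = 1`). -/
def SupercriticalRadiusMoment : Prop :=
  ∀ p : unitInterval, criticalProb (zdGraph 3) (0 : Site 3) < (p : ℝ) →
    Summable fun n : ℕ => ((n : ℝ) + 1) ^ 2 * (bondPercolation (zdGraph 3) p).real (siteToBoundary 3 n \ percolatesAt 0)

/-- The birth line's STUB 1 statement (the supercritical regime on the volume law, a theorem in print):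
`p_c < p ⇒ χᶠ(p) < ∞`. Spelled verbatim as the support item stmt-CriticalPhenomena-0854
(`supercriticalChiFinite_iff_item`); it is STUB 3 ∘ STUB 1 (`supercriticalChiFinite_of_stubs`). -/
def SupercriticalChiFinite : Prop :=
  ∀ p : unitInterval, Literature.Probability.Percolation.criticalProb (Literature.Probability.LatticeModels.zdGraph 3) 0 < (p : ℝ) → Summable fun x : Literature.Probability.LatticeModels.Site 3 => (Literature.Probability.Percolation.bondPercolation (Literature.Probability.LatticeModels.zdGraph 3) p).real (Literature.Probability.Percolation.openConn 0 x \ Literature.Probability.Percolation.percolatesAt 0)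

/-- STUB 2 statement (the live case, one level below the crux): at a percolating `p_c`, finite second
radius moment of the finite cluster of the origin. -/
def CriticalRadiusMoment : Prop :=
  0 < theta (zdGraph 3) (0 : Site 3) (criticalProbI 3) →
    Summable fun n : ℕ => ((n : ℝ) + 1) ^ 2 * (bondPercolation (zdGraph 3) (criticalProbI 3)).real (siteToBoundary 3 n \ percolatesAt 0)

/-- STUB 3 statement (volume from radius, at every `p`). -/
def ChiFiniteOfRadiusMoment : Prop :=
  ∀ p : unitInterval,
    (Summable fun n : ℕ => ((n : ℝ) + 1) ^ 2 * (bondPercolation (zdGraph 3) p).real (siteToBoundary 3 n \ percolatesAt 0)) →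
      Summable fun x : Site 3 => (bondPercolation (zdGraph 3) p).real (openConn 0 x \ percolatesAt 0)

/-! ## Registered stubs (signatures spelled out verbatim; `stub_X : X` holds by `Iff.rfl`, see `stub_iff`) -/

/-- **STUB 1 `supercriticalRadiusMoment`** (KNOWN; provable now): for `p > p_c(ℤ³)`,
`Σ_n (n+1)² P_p(0 ↔ ∂B(n), |C(0)| < ∞) < ∞`. In print: Grimmett 1999 Thm (8.21) (`P_p(0 ↔ ∂B(n), |C| < ∞)
≤ e^{−nσ(p)}`, `σ(p) > 0` for `p > p_c`, pp. 210–212, Chayes–Chayes–Newman 1987 over Grimmett–Marstrand).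
In tree: for `p ∈ (p_c, 1)` the discharged `DuminilcopinKozmaTassion2020_thm2_supercritical_holds` (d = 3)
gives `0 < exp(−C/(p−p_c)²) ≤ liminf_n −(1/n)·log P_p[siteToBoundary 3 n ∩ (percolatesAt 0)ᶜ]`
(`Set.diff_eq` identifies the event with `radF`'s), so `radF p n ≤ exp(−c n)` eventually
(`Filter.eventually_lt_of_lt_liminf`, the rate sequence is bounded below by `0`) and the series is
dominated eventually by `(n+1)² e^{−cn}` (`Real.summable_pow_mul_exp_neg_nat_mul`,
`summable_of_isBigO_nat` / `Summable.of_norm_bounded_eventually`); for `p = 1`, `DCT16.theta_one`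
(`θ(1) = 1`) makes `radF 1 ≡ 0` (`radF 1 n ≤ P_1((percolatesAt 0)ᶜ) = 1 − θ(1) = 0`). -/
theorem stub_supercriticalRadiusMoment :
    ∀ p : unitInterval, criticalProb (zdGraph 3) (0 : Site 3) < (p : ℝ) →
      Summable fun n : ℕ => ((n : ℝ) + 1) ^ 2 * (bondPercolation (zdGraph 3) p).real (siteToBoundary 3 n \ percolatesAt 0) :=
  -- LANDED (wave 1, p147056): Theorems/PercNecklaceBackboneTruncatedSusceptibilityFiniteOfThetaStubSupercriticalRadiusMoment.lean
  Summit.CriticalPhenomena.PercolationContinuityZ3.Theorems.TruncatedSusceptibilityFiniteOfTheta.stub_supercriticalRadiusMoment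

/-- **STUB 2 `criticalRadiusMoment`** (OPEN — LOAD-BEARING): `θ(p_c) > 0 ⇒ Σ_n (n+1)² P_{p_c}(0 ↔ ∂B(n),
|C(0)| < ∞) < ∞`. The hypothetical percolating critical point must have finite clusters with a light
radius tail (second shell moment). Implied by the `p_c`-instance of the sibling crux stmt-0853
(`criticalRadiusMoment_of_expDecay`); vacuous if `θ(p_c) = 0`. Why it might fail: the only engine in
print (Grimmett 1999 (8.21)) needs a slab percolating AT `p`, none does at `p_c` (DST 2016, in tree as
`DuminilCopinSidoraviciusTassion2016`); barrier `SprinklingRenormalisation` head-on; `θ > 0` with heavy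
truncated tails does occur off-lattice (Imbrie–Newman 1988 Cor 1.5, 1-d `1/r²` model). -/
theorem stub_criticalRadiusMoment :
    0 < theta (zdGraph 3) (0 : Site 3) (criticalProbI 3) →
      Summable fun n : ℕ => ((n : ℝ) + 1) ^ 2 * (bondPercolation (zdGraph 3) (criticalProbI 3)).real (siteToBoundary 3 n \ percolatesAt 0) := by
  sorry

/-- **STUB 3 `chiFiniteOfRadiusMoment`** (M, PROVABLE NOW): at every `p`,
`Σ_n (n+1)² P_p(0 ↔ ∂B(n), |C| < ∞) < ∞ ⇒ Σ_x P_p(0 ↔ x, |C| < ∞) < ∞`. First exit (a.s., `ω ⊆ E(ℤ³)`):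
for `‖x‖_∞ = m ≥ 1`, `{0 ↔ x, |C| < ∞} ⊆ {0 ↔ ∂B(m−1), |C| < ∞}` (`tau_le_real_siteToBoundary` pattern,
`DCT16.real_mono_of_forall_subset_edgeSet`); shell count `#{‖x‖_∞ = m} = 24m² + 2` (`card_box`);
comparison of nonnegative series after reindexing `Site 3` by shells. -/
theorem stub_chiFiniteOfRadiusMoment :
    ∀ p : unitInterval,
      (Summable fun n : ℕ => ((n : ℝ) + 1) ^ 2 * (bondPercolation (zdGraph 3) p).real (siteToBoundary 3 n \ percolatesAt 0)) →
        Summable fun x : Site 3 => (bondPercolation (zdGraph 3) p).real (openConn 0 x \ percolatesAt 0) :=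
  -- LANDED (wave 1, p147195): Theorems/PercNecklaceBackboneTruncatedSusceptibilityFiniteOfThetaStubChiFiniteOfRadiusMoment.lean
  Summit.CriticalPhenomena.PercolationContinuityZ3.Theorems.TruncatedSusceptibilityFiniteOfTheta.stub_chiFiniteOfRadiusMoment

/-- The registered stub texts are the three named statements (definitional). -/
theorem stub_iff :
    (SupercriticalRadiusMoment ↔
      ∀ p : unitInterval, criticalProb (zdGraph 3) (0 : Site 3) < (p : ℝ) →
        Summable fun n : ℕ => ((n : ℝ) + 1) ^ 2 * (bondPercolation (zdGraph 3) p).real (siteToBoundary 3 n \ percolatesAt 0)) ∧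
    (CriticalRadiusMoment ↔
      (0 < theta (zdGraph 3) (0 : Site 3) (criticalProbI 3) →
        Summable fun n : ℕ => ((n : ℝ) + 1) ^ 2 * (bondPercolation (zdGraph 3) (criticalProbI 3)).real (siteToBoundary 3 n \ percolatesAt 0))) ∧
    (ChiFiniteOfRadiusMoment ↔
      ∀ p : unitInterval,
        (Summable fun n : ℕ => ((n : ℝ) + 1) ^ 2 * (bondPercolation (zdGraph 3) p).real (siteToBoundary 3 n \ percolatesAt 0)) →
          Summable fun x : Site 3 => (bondPercolation (zdGraph 3) p).real (openConn 0 x \ percolatesAt 0)) :=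
  ⟨Iff.rfl, Iff.rfl, Iff.rfl⟩

/-! ### Name-keyed aliases of the stub statements
`__Registered.stub_X` is statement `X` under the registered stub's short name, so that the native skeleton
audit (`#h21_check_skeleton`: hypotheses admissible iff registered obligations / declared stubs BY NAME)
accepts `TruncatedSusceptibilityFiniteOfTheta_of : __Registered.stub_… → … → TruncatedSusceptibilityFiniteOfTheta`
(device of `Cruxes/BGNOffTheFloor/Lines/birth.lean`; the `@[stub]` attribute is gate-reserved). -/
namespace __Registered

/-- Alias of `SupercriticalRadiusMoment` keyed by the registered stub name. -/
abbrev stub_supercriticalRadiusMoment : Prop := SupercriticalRadiusMoment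
/-- Alias of `CriticalRadiusMoment` keyed by the registered stub name. -/
abbrev stub_criticalRadiusMoment : Prop := CriticalRadiusMoment
/-- Alias of `ChiFiniteOfRadiusMoment` keyed by the registered stub name. -/
abbrev stub_chiFiniteOfRadiusMoment : Prop := ChiFiniteOfRadiusMoment

end __Registered

/-! ## Proved plumbing -/

/-- `θ(p) > 0 ⇒ p_c ≤ p` (`p_c = inf ({p | θ(p) > 0} ∪ {1})`, Grimmett 1999 (1.11); no coupling needed). -/
theorem criticalProb_le_of_theta_pos' {p : unitInterval} (h : 0 < theta (zdGraph 3) (0 : Site 3) p) :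
    criticalProb (zdGraph 3) (0 : Site 3) ≤ (p : ℝ) := by
  refine csInf_le ⟨0, ?_⟩ (Or.inl ⟨p.2, by simpa using h⟩)
  rintro r (⟨hr, -⟩ | hr)
  · exact hr.1
  · rw [Set.mem_singleton_iff] at hr
    rw [hr]; exact zero_le_one

/-- The regime split: a percolating `p` is either the critical point itself or strictly supercritical. -/
theorem eq_criticalProbI_or_lt {p : unitInterval} (h : 0 < theta (zdGraph 3) (0 : Site 3) p) :
    p = criticalProbI 3 ∨ criticalProb (zdGraph 3) (0 : Site 3) < (p : ℝ) := by
  rcases (criticalProb_le_of_theta_pos' h).eq_or_lt with heq | hlt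
  · exact Or.inl (Subtype.ext (by rw [coe_criticalProbI]; exact heq.symm))
  · exact Or.inr hlt

/-- The birth STUB 1 (`SupercriticalChiFinite`) is verbatim the support item stmt-CriticalPhenomena-0854 of
route PercTruncatedSusceptibility. -/
theorem supercriticalChiFinite_iff_item :
    SupercriticalChiFinite ↔
      Summit.CriticalPhenomena.PercolationContinuityZ3.Theses.PercTruncatedSusceptibility.TruncatedSusceptibilityFiniteSupercrit :=
  Iff.rfl

/-- `SupercriticalChiFinite` is a CONSEQUENCE of the crux (honest piece): `p > p_c ⇒ θ(p) > 0`
(`theta_pos_of_criticalProb_lt_holds`), then L. -/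
theorem supercriticalChiFinite_of_crux (h : TruncatedSusceptibilityFiniteOfTheta) : SupercriticalChiFinite :=
  fun p hp => h p (theta_pos_of_criticalProb_lt_holds (zdGraph 3) (0 : Site 3) p hp)

/-- STUBS 1 and 3 give the birth line's volume-law STUB 1, i.e. item stmt-CriticalPhenomena-0854
(`supercriticalChiFinite_iff_item`): `p_c < p ⇒ χᶠ(p) < ∞`. -/
theorem supercriticalChiFinite_of_stubs (h₁ : SupercriticalRadiusMoment) (h₃ : ChiFiniteOfRadiusMoment) :
    SupercriticalChiFinite :=
  fun p hp => h₃ p (h₁ p hp)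

/-- STUBS 2 and 3 give exactly the live case of the crux: `θ(p_c) > 0 ⇒ χᶠ(p_c) < ∞`. -/
theorem chiFinite_critical_of (h₂ : CriticalRadiusMoment) (h₃ : ChiFiniteOfRadiusMoment)
    (hθ : 0 < theta (zdGraph 3) (0 : Site 3) (criticalProbI 3)) : ChiFinite (criticalProbI 3) :=
  h₃ _ (h₂ hθ)

theorem radF_nonneg (p : unitInterval) (n : ℕ) : 0 ≤ radF p n := measureReal_nonneg

/-- STUB 2 is implied by (the `p_c`-instance of) the sibling crux stmt-CriticalPhenomena-0853
`FiniteRadiusExpDecayOfTheta` (exponential radius decay of finite clusters wherever `θ > 0`). -/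
theorem criticalRadiusMoment_of_expDecay
    (h : Summit.CriticalPhenomena.PercolationContinuityZ3.Theses.PercTruncatedSusceptibility.FiniteRadiusExpDecayOfTheta) :
    CriticalRadiusMoment := by
  intro hθ
  obtain ⟨c, hc, hle⟩ := h (criticalProbI 3) hθ
  -- dominating series: (n+1)² e^{-cn} = n² e^{-cn} + 2 n e^{-cn} + e^{-cn}
  have h2 := Real.summable_pow_mul_exp_neg_nat_mul 2 hc
  have h1 := Real.summable_pow_mul_exp_neg_nat_mul 1 hc
  have h0 := Real.summable_pow_mul_exp_neg_nat_mul 0 hc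
  have hdom : Summable fun n : ℕ => ((n : ℝ) + 1) ^ 2 * Real.exp (-c * n) := by
    have := (h2.add (h1.mul_left 2)).add h0
    refine this.congr fun n => ?_
    simp only [pow_zero, pow_one, one_mul]
    ring
  refine hdom.of_nonneg_of_le (fun n => mul_nonneg (by positivity) (radF_nonneg _ n)) fun n => ?_
  exact mul_le_mul_of_nonneg_left (hle n) (by positivity)

/-! ## The composition, by name -/

/-- **`TruncatedSusceptibilityFiniteOfTheta_of`**: the one OPEN registered stub implies the crux
`Summit.CriticalPhenomena.PercolationContinuityZ3.Theses.PercNecklaceBackbone.TruncatedSusceptibilityFiniteOfTheta`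
(kernel-checked; no `sorry` outside the stub). Regime split at `p_c`; the supercritical regime and the
radius-to-volume passage are the two LANDED stubs (`stub_supercriticalRadiusMoment`, p147056;
`stub_chiFiniteOfRadiusMoment`, p147195), discharged inside the proof. -/
theorem TruncatedSusceptibilityFiniteOfTheta_of (hcrit : __Registered.stub_criticalRadiusMoment) :
    Summit.CriticalPhenomena.PercolationContinuityZ3.Theses.PercNecklaceBackbone.TruncatedSusceptibilityFiniteOfTheta := by
  intro p hθ
  rcases eq_criticalProbI_or_lt hθ with rfl | hlt
  · exact stub_chiFiniteOfRadiusMoment _ (hcrit hθ)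
  · exact stub_chiFiniteOfRadiusMoment _ (stub_supercriticalRadiusMoment p hlt)

/-- The same composition concludes the crux's home-route decl (shared item, identical text). -/
theorem TruncatedSusceptibilityFiniteOfTheta_of' (hcrit : __Registered.stub_criticalRadiusMoment) :
    Summit.CriticalPhenomena.PercolationContinuityZ3.Theses.PercTruncatedSusceptibility.TruncatedSusceptibilityFiniteOfTheta :=
  TruncatedSusceptibilityFiniteOfTheta_of hcrit

/-- Wiring check: the registered open stub feeds `TruncatedSusceptibilityFiniteOfTheta_of` as stated. -/
example : Summit.CriticalPhenomena.PercolationContinuityZ3.Theses.PercNecklaceBackbone.TruncatedSusceptibilityFiniteOfTheta :=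
  TruncatedSusceptibilityFiniteOfTheta_of stub_criticalRadiusMoment

/-! ## Where the open stub sits (lead c3, 2026-08-17; all kernel-checked in landed `--supports` files)

* It is implied by each sibling "thin critical dust" crux: 0853@p_c (`criticalRadiusMoment_of_expDecay` above;
  `TruncatedSusceptibilityFiniteOfTheta_of_FiniteRadiusExpDecayOfTheta`, p150587), 0943 `FiniteClusterVolumeTail`
  (`stub_criticalRadiusMoment_of_FiniteClusterVolumeTail`, p158238), 7204's `stub_thinDust` (`stub_criticalRadiusMoment_of_thinDust`,
  p156696); and the crux by 6065 `FiniteClusterMomentsOfTheta` (p158238).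
* Its conclusion forces its hypothesis (`stub_theta_pos_of_radiusMoment`, p158238): it cannot be had unconditionally.
* CERTIFICATE (p158555, p158780, p159081): by the radius quarantine sandwich `u_n(p) · P_p(0 ↔ ∂Λ_n) ≤ P_p(0 ↔ ∂Λ_n, |C(0)| < ∞)`
  (`blockProb_mul_real_siteToBoundary_le`), the stub is EQUIVALENT TO THE CONJUNCT `θ(p_c) = 0` modulo non-summable critical
  annulus blocking, and the crux itself modulo `Σ u_n(p_c) = ∞ ∨ u_n(p_c) ≠ O(1/n)`; in particular under crux
  `PercNonProliferation.SubpolynomialBlocking` (stmt-4446) both are certified restatements of `PercolationContinuityZ3`. -/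
example (hU : ¬ Summable fun n : ℕ =>
      Summit.CriticalPhenomena.PercolationContinuityZ3.Theorems.SubpolynomialBlocking.Negative.blockProb 3 (criticalProbI 3) n) :
    __Registered.stub_criticalRadiusMoment ↔ _root_.PercolationContinuityZ3 :=
  Summit.CriticalPhenomena.PercolationContinuityZ3.Theorems.TruncatedSusceptibilityFiniteOfTheta.criticalRadiusMoment_iff_summit_of_not_summable_blocking hU

example (h4 : Summit.CriticalPhenomena.PercolationContinuityZ3.Theses.PercNonProliferation.SubpolynomialBlocking) :
    __Registered.stub_criticalRadiusMoment ↔ _root_.PercolationContinuityZ3 :=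
  Summit.CriticalPhenomena.PercolationContinuityZ3.Theorems.TruncatedSusceptibilityFiniteOfTheta.stub_criticalRadiusMoment_iff_summit_of_subpolynomialBlocking h4

example (h4 : Summit.CriticalPhenomena.PercolationContinuityZ3.Theses.PercNonProliferation.SubpolynomialBlocking) :
    Summit.CriticalPhenomena.PercolationContinuityZ3.Theses.PercNecklaceBackbone.TruncatedSusceptibilityFiniteOfTheta ↔
      _root_.PercolationContinuityZ3 :=
  Summit.CriticalPhenomena.PercolationContinuityZ3.Theorems.TruncatedSusceptibilityFiniteOfTheta.TruncatedSusceptibilityFiniteOfTheta_iff_summit_of_subpolynomialBlocking h4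

/-! ## Second certificate (lead c4, 2026-08-17; p162784 `…TruncatedSusceptibilityFiniteOfThetaOfRayRenewal.lean`)

The open stub and the crux are ALSO the conjunct modulo the two-arms ratio law T2 of route `PercRayRenewal`
(`TwoArmsRatioExponent`, stmt-4625: `P_{p_c}(A₂(r,n)) ≤ C (r/n)^{c₂}`, `c₂ > 1`): the stub's conclusion `RM(p_c)` gives the
power-law radius tail `JumpTruncatedOneArmDecay` (G1′, `a = 2`), the crux gives it with `a = 1` (`(n+1) g(n) ≤ χᶠ(p_c)`), and
the PROVED ray-renewal assembly `percRayRenewalAssembly_proof : T2 → G → θ(p_c) = 0` (Kozma–Nitzan 2024 §1 items 4–5: BGN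
shattering + renewal along a ray) with `G ↔ G1′` closes the conjunct. So a proof of `stub_criticalRadiusMoment` is a proof of
`θ(p_c) = 0` in every world where EITHER critical annulus blocking is polynomially visible (c3) OR T2 holds (c4). -/
example (hcrit : __Registered.stub_criticalRadiusMoment) :
    Summit.CriticalPhenomena.PercolationContinuityZ3.Theses.PercRayRenewal.JumpTruncatedOneArmDecay :=
  Summit.CriticalPhenomena.PercolationContinuityZ3.Theorems.TruncatedSusceptibilityFiniteOfTheta.jumpTruncatedOneArmDecay_of_criticalRadiusMoment hcrit

example (hT2 : Summit.CriticalPhenomena.PercolationContinuityZ3.Theses.PercRayRenewal.TwoArmsRatioExponent) :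
    __Registered.stub_criticalRadiusMoment ↔ _root_.PercolationContinuityZ3 :=
  Summit.CriticalPhenomena.PercolationContinuityZ3.Theorems.TruncatedSusceptibilityFiniteOfTheta.stub_criticalRadiusMoment_iff_summit_of_twoArmsRatioExponent hT2

example (hT2 : Summit.CriticalPhenomena.PercolationContinuityZ3.Theses.PercRayRenewal.TwoArmsRatioExponent) :
    Summit.CriticalPhenomena.PercolationContinuityZ3.Theses.PercNecklaceBackbone.TruncatedSusceptibilityFiniteOfTheta ↔
      _root_.PercolationContinuityZ3 :=
  Summit.CriticalPhenomena.PercolationContinuityZ3.Theorems.TruncatedSusceptibilityFiniteOfTheta.TruncatedSusceptibilityFiniteOfTheta_iff_summit_of_twoArmsRatioExponent hT2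

/-! ## Third certificate (lead c5, 2026-08-17; p166456 `…TruncatedSusceptibilityFiniteOfThetaOfLineAvoidance.lean`)

In the jump world the stub's conclusion `RM(p_c)` makes the line-avoidance probabilities
`e_m = P_{p_c}(e₀ ↮ ∞, …, m e₀ ↮ ∞)` SUMMABLE (`summable_lineVac_of_radiusMoment`: condensed box chain,
`e_{2^k} ≤ 16 S k⁶ 4^{-k} + (1 − θ₀)^{k²}`, i.e. `e_m = O((log m)⁶ m^{-2})`), which is the hypothesis `E|x| < ∞`
of the les Diablerets criterion (Kozma–Nitzan 2024 §1 item 4: "if `E(|x|) < ∞` then `θ(p_c) = 0` — a simple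
corollary of Barsky–Grimmett–Newman, never published"). So the open stub is ALSO the conjunct modulo that
criterion — an input claimed to be a THEOREM (BGN is proved in the tree) whose proof is not in print and which
no lead of this chain or of crux `JumpLineAvoidanceDecay` could reconstruct without T2. The landed statements
(module `…Theorems.PercNecklaceBackboneTruncatedSusceptibilityFiniteOfThetaOfLineAvoidance`, not imported here):

  `summable_lineVac_of_radiusMoment : 0 < θ(p_c) → RM(p_c) → Summable (m ↦ P_{p_c}{∀ 1 ≤ i ≤ m, i e₀ ↮ ∞})`
  `stub_criticalRadiusMoment_iff_summit_of_diablerets :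
      (Summable (m ↦ P_{p_c}{∀ 1 ≤ i ≤ m, i e₀ ↮ ∞}) → PercolationContinuityZ3) →
        (__Registered.stub_criticalRadiusMoment ↔ PercolationContinuityZ3)`  (registered structural stub). -/

end Summit.CriticalPhenomena.PercolationContinuityZ3.Cruxes.TruncatedSusceptibilityFiniteOfTheta.Birth

end
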